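import Summits.QuantumFields.YangMills.Theorems.BalabanUVNodesN11TStepOldBranchInnerChart
import Summits.QuantumFields.YangMills.Theorems.BalabanUVNodesN11TStepOldBranchGraphIntegrable
import Literature.MathematicalPhysics.QuantumFieldTheory.Balaban1983to89.B14SeparationOfRecord

/-!
# DAG node N11 — (O3′) AT A FLUCTUATION-PRODUCT SOCKET UNDER 11a's WEIGHT LAWS: the slice-integrability row of the NEW side DROPPED (nonnegative summands of an integrable sum are
# integrable), the `ζ = 0` slice handled apart — displayed: the chart data, the rows, and the per-fluctuation-slice identity of (3.23) alone

HEADER — WORK-UNIT METADATA.  Cell `pub-ymgap`, YM-PLAN Track A (HUMAN RULING D-0062), WIDTH SEAT `pub-ymgap-dag-n11-w6` (g3; R399 (3a) re-mint) on NODE n11 [B14],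
route `BalabanUVNodes` rev 29, jail key K1⁷ `StabilityBAtRecordR13SepCoPH` = stmt-QuantumFields-20542 (helper lane, `--kind proof --supports stmt-QuantumFields-20542 --as helper`,
count-neutral; K1⁹ = stmt-QuantumFields-27364 of record — dag-lead KEY MAP v2, MIS-KEY rule R463 (4)(a)).  [I] = [Balaban1987RG1], [III] = [Balaban1988Convergent].
Companion of this seat's `…N11TStepOldBranchInnerChartFluctuationSlices` (p633779: E′∕G′ — (O3′) from dag-n11-d's E at a socket `X = (↥sA → V) × X₂`, `κ = Kernel.const _ (⊗_{sA} Lebesgue)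
⊗ₖ κ₂`, modulo (hIslice) the chart-side integrability, (hYint) Lebesgue-integrability of the new `Y`-slices and (hslice) the per-fluctuation-slice identity).

WHY THIS FILE.  (hYint) is NOT chart-side content: under 11a's weight laws (`ζ ≥ 0`, `0 ≤ χ ≤ 1`, hence `w ≥ 0`) and a nonnegative new operand (print's `e^{A_{k+1}}`, an exponential),
every new `Y`-slice `a ↦ w_{S₀,Y}(ω_{y,a})·(𝐓_k(init s′,S₀)[W]Φ_{S₀∪Y})(ω_{y,a})` is a NONNEGATIVE measurable function, and on a slice where `ζ_k(ω_y) ≠ 0` their sum over `Y` is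
`ζ_k(ω_y)⁻¹ ×` the slice integral of the charted old piece — Lebesgue-integrable by (hIslice) and Fubini (`Integrable.integral_compProd`) — so each slice is integrable
(`Finset.single_le_sum`); where `ζ_k(ω_y) = 0` both members of `hinner₀` vanish.  THIS FILE proves E′∕G′ with (hYint) REPLACED by the rows that carry this: at the generic letters
`hW : W.Laws`, `0 ≤ Φ`, measurability of the new weights' `ζ_j(Y)` ∕ `w_j(Λ′,Y,S)` and of the new operand at every branch; at the Stage-13 letters `zhLaws` (already displayed by G)
and the positivity of `sect2Operand` DISCHARGE the first two (`WtOfRecord₁₃H_laws`, `sect2Operand_pos`), leaving measurability of the NEW history's `ζ0_j(Y)` ∕ `quad_j(Λ′)` and of the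
new operand.  NET at Record 13: (O3′)'s disjunction from Theorem 1's level-`k` form + def-T's `hG` + `zhLaws` + rows + the socket + `hwS` + `hint` + (hIslice) + THE PER-SLICE IDENTITY.

WHAT THIS FILE PROVES (0 `def`, 0 `sorry`, standard axioms).  §1 `integral_compProd_const_eq_sum_mul_integral_of_nonneg_slices` (generic: Fubini over `Kernel.const _ μ ⊗ₖ η` when the
slices are a.e. `c · Σ_i g_i` with `g_i ≥ 0` measurable — NO integrability of the `g_i` assumed; `c = 0` apart, else from the integrable sum) · §2 ★★★★★★
`slotsTOfRecord_succ_ae_eq_TkOfRecord_succ_of_oldBranchInnerChart_fluctuationSlices_of_weightLaws` · §3 ★★★★★★★ `slotsTOfRecord₁₃H_succ_O3_of_hasSect2FormAtZS_of_fluctuationSlices_of_weightLaws`.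

HONEST FRAMING.  Helper lane, count-neutral; compositions BY NAME (E + 11a's laws∕positivity + g10's measurability + Mathlib's kernel Fubini); socket data ∕ rows ∕ per-slice identity
DISPLAYED; NO chart of Bałaban's ((47), [III] (3.10)–(3.25)) asserted; NO Jacobian evaluated; NO Gaussian integration performed; nothing of [I] §2 ∕ [III] §3 ∕ Thm 2 asserted;
(B4) ∕ (S-α) ∕ (O3′) NOT closed; N11 NOT discharged; K1⁷ ∕ K1⁹ NOT closed, no registered stub touched; counts unmoved (typed 28∕28 · discharged 5∕27 · A 5∕28).  One finite
`𝕋⁴_{L^K}` programme at fixed `ε = L^{−K}`; R4 closes only the conditional finite-𝕋⁴ rung `BalabanLadder.UV` — NOT ℝ⁴, NOT OS, NOT a mass gap, NOT Clay.  No `sorry`, `axiom`, `def`,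
`instance`, `notation`.  Sources (SHAPE ∕ bookkeeping only): [I] (0.4) p.253, §2 p.267; [III] (2.18) p.257, (2.20)–(2.21) p.258, (3.1) p.264, (3.2)–(3.5) p.265, (3.23)–(3.25) p.270, §3 p.279.
-/

noncomputable section

open MeasureTheory ProbabilityTheory
open scoped ENNReal NNReal BigOperators

namespace Summit.QuantumFields.YangMills.Theorems.BalabanUVNodesN11TStepOldBranchInnerChartFluctuationSlicesOfWeightLaws

open Literature.MathematicalPhysics.QuantumFieldTheory.Balaban1983to89
open Literature.MathematicalPhysics.QuantumFieldTheory.Balaban1983to89.T4AveragingDisintegration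
open BalabanUVNodesN11TStepOldBranchInnerChart (slotsTOfRecord_succ_ae_eq_TkOfRecord_succ_of_oldBranchInnerChart)
open BalabanUVNodesN11TStepBranchSumOldIndex (genDataOfRecord_zeta genDataOfRecord_sA genDataOfRecord_w)
open BalabanUVNodesN11TStepOldBranchGraphIntegrable (tkBranchOfRecord_nonneg integrable_oldBranch_pieces₁₃H_of_integrable_graph)
open BalabanUVNodesN11TkOpMeasurable (measurable_tkOp measurable_genOp_genDataOfRecord measurable_tkWeightsOfRecordP_ζ measurable_tkWeightsOfRecordP_w)
open Literature.MathematicalPhysics.QuantumFieldTheory.Balaban1983to89.B14SeparationOfRecord (slotsTOfRecord_succ_eq_zero_of_init_eq_zero)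
open Node00 hiding SU
open Node00.Tk T4Continuum B14.Eq218Concrete
open B10Eq42TorusConstraint (bondsIn)
open T4AdjointCovariance (insA)

/-! ## §1  Fubini over a constant first factor with NONNEGATIVE slice summands: no slice integrability assumed (generic) -/

section Generic

variable {Z A X : Type*} [MeasurableSpace Z] [MeasurableSpace A] [MeasurableSpace X]

/-- **FUBINI FACE, NONNEGATIVE SLICES.**  For `f` integrable on the product fibre `(Kernel.const _ μ ⊗ₖ η) z`: if `μ`-a.e. slice integral `∫ f(a,x) η((z,a))(dx)` is `c · Σ_{i∈ι} g_i a`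
with every `g_i` NONNEGATIVE and measurable, then `∫ f d((const μ ⊗ₖ η) z) = Σ_i c · ∫ g_i dμ` — for `c = 0` both sides vanish; for `c ≠ 0` the sum is `μ`-integrable
(`Integrable.integral_compProd`), hence so is each nonnegative summand (`Finset.single_le_sum`), and linearity applies. [cite: Balaban1988Convergent, (3.23) p.270 (bookkeeping)] -/
theorem integral_compProd_const_eq_sum_mul_integral_of_nonneg_slices (μ : Measure A) [SFinite μ] (η : Kernel (Z × A) X) [IsSFiniteKernel η] (z : Z)
    {f : A × X → ℝ} (hf : Integrable f ((Kernel.const Z μ ⊗ₖ η) z)) (c : ℝ) {I : Type*} (ι : Finset I) {g : I → A → ℝ}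
    (hg0 : ∀ i ∈ ι, ∀ a, 0 ≤ g i a) (hgm : ∀ i ∈ ι, Measurable (g i))
    (hs : ∀ᵐ a ∂μ, ∫ x, f (a, x) ∂(η (z, a)) = c * ∑ i ∈ ι, g i a) :
    ∫ p, f p ∂((Kernel.const Z μ ⊗ₖ η) z) = ∑ i ∈ ι, c * ∫ a, g i a ∂μ := by
  rw [ProbabilityTheory.integral_compProd hf, Kernel.const_apply, integral_congr_ae hs]
  by_cases hc : c = 0
  · simp [hc]
  · have hF : Integrable (fun a => ∫ x, f (a, x) ∂(η (z, a))) μ := by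
      simpa [Kernel.const_apply] using hf.integral_compProd
    have h1 : Integrable (fun a => c * ∑ i ∈ ι, g i a) μ := hF.congr hs
    have h2 : Integrable (fun a => ∑ i ∈ ι, g i a) μ := by
      simpa [← mul_assoc, inv_mul_cancel₀ hc] using h1.const_mul c⁻¹
    have h3 : ∀ i ∈ ι, Integrable (g i) μ := fun i hi =>
      h2.mono (hgm i hi).aestronglyMeasurable (Filter.Eventually.of_forall fun a => by
        rw [Real.norm_of_nonneg (hg0 i hi a), Real.norm_of_nonneg (Finset.sum_nonneg fun j hj => hg0 j hj a)]
        exact Finset.single_le_sum (fun j hj => hg0 j hj a) hi)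
    rw [integral_const_mul, integral_finsetSum ι h3, Finset.mul_sum]

end Generic

/-! ## §2  E at a fluctuation-product socket under the weight laws: (hYint) dropped -/

section Slices

variable {F : T4Family} {N : ℕ} [NeZero N]
variable {V : Type} [NormedAddCommGroup V] [InnerProductSpace ℝ V] [FiniteDimensional ℝ V] [MeasurableSpace V] [BorelSpace V]

/-- ★★★★★★ **(O3′) ON THE NOSE AT A FLUCTUATION-PRODUCT SOCKET UNDER 11a's WEIGHT LAWS.**  E′ (p633779 §2) with the slice-integrability row (hYint) REPLACED by `hW : W.Laws`, `0 ≤ Φ`,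
measurability of `W.ζ j Y` ∕ `W.w j Λ′ Y S` and of the new operand at every branch; displayed chart-side content: (hIslice) + (hslice).  PROOF: dag-n11-d's E ★★★★★★ with `hinner₀ :=`
11a's `zetaOp_apply`∕`aOp_apply` + C1's `rfl` projections on the right member, then §1 with `g_Y a := w_{S₀,Y}(ω_{y,a})·(𝐓_k(init s′,S₀)[W]Φ_{S₀∪Y})(ω_{y,a})` — nonnegative by
`TkWeights.w_nonneg` + D's `tkBranchOfRecord_nonneg`, measurable by g10's `measurable_tkOp`∕`measurable_genOp_genDataOfRecord` along the measurable slice map `a ↦ ω_{y,a}`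
(`measurable_update`, `measurable_updateFinset`). [cite: Balaban1987RG1, (0.4) p.253, §2 p.267; Balaban1988Convergent, (2.18) p.257, (2.20)–(2.21) p.258, (3.1) p.264, (3.2)–(3.5) p.265, (3.23)–(3.25) p.270, §3 p.279] -/
theorem slotsTOfRecord_succ_ae_eq_TkOfRecord_succ_of_oldBranchInnerChart_fluctuationSlices_of_weightLaws (ν : Stage7Numerics) (τ : TowerNumerics) (E : B12.RunParams → ℝ)
    (w : StepWeightsOfRecord F N ν τ.M) (ppSel : PpSelOfRecord F ν τ.M) (p : B12.RunParams) (g : ℕ → ℝ) {k : ℕ} (hkK : k < p.K)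
    {hdec : DecidableEq (PBond (F.P p.K) k)} {hdec' : DecidableEq (PBond (F.P p.K) (k + 1))} (hk : k + 1 ≤ (F.P p.K).m + (F.P p.K).K)
    (s' : SeqOfRecord F ν τ.M g p.K (k + 1)) (W₀ W : TkWeights F N V p.K)
    (Φ₀ Φ : SFluct (F.P p.K) V → B15DeterminingSets.MSField (F.P p.K) (SU N) → ℝ)
    (hform : ∀ᵐ U ∂fieldMeasure (F.P p.K) k (SU N), chiSeqOfRecord F N ν τ.M g p.K k s'.init U ≠ 0 →
      slotsOfRecord F N ν τ E w ppSel p g k s'.init U = TkOfRecord F N V ν τ.M g p.K W₀ k s'.init Φ₀ U)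
    (hG₀ : ∀ S₀ ∈ admSOfRecord F ν τ.M g p.K k s'.init, Integrable (fun U => w p g k s' U ((avOfRecord F N p.K k).avg U) *
        (chiSeqOfRecord F N ν τ.M g p.K k s'.init U *
          tkBranchOfRecord F N V ν τ.M g p.K W₀ s'.init S₀ k (fun ω => Φ₀ (S₀, fun j => (ω j).2) (fun j => (ω j).1)) (baseCfg k U)))
      (fieldMeasure (F.P p.K) k (SU N)))
    {X₂ : Type*} [MeasurableSpace X₂] (κ₂ : Kernel (((↥(Set.toFinite (bondsIn k (s'.Ω (k + 1))ᶜ)).toFinset → SU N) × ({c : PBond (F.P p.K) (k + 1) // c ∉ (Set.toFinite (bondsIn (k + 1) (s'.Ω (k + 1))ᶜ)).toFinset} → SU N)) × (↥(Set.toFinite (bondsIn k ((s'.Λ (k + 1))ᶜ ∩ s'.Ω (k + 1)))).toFinset → V)) X₂) [IsSFiniteKernel κ₂]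
    {Ψ : ((↥(Set.toFinite (bondsIn k (s'.Ω (k + 1))ᶜ)).toFinset → SU N) × ({c : PBond (F.P p.K) (k + 1) // c ∉ (Set.toFinite (bondsIn (k + 1) (s'.Ω (k + 1))ᶜ)).toFinset} → SU N)) × ((↥(Set.toFinite (bondsIn k ((s'.Λ (k + 1))ᶜ ∩ s'.Ω (k + 1)))).toFinset → V) × X₂) → (↥(Set.toFinite (bondsIn k (s'.Ω (k + 1))ᶜ)).toFinset → SU N) × ({b : PBond (F.P p.K) k // b ∉ (Set.toFinite (bondsIn k (s'.Ω (k + 1))ᶜ)).toFinset} → SU N)} (hΨ : Measurable Ψ)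
    {J : ((↥(Set.toFinite (bondsIn k (s'.Ω (k + 1))ᶜ)).toFinset → SU N) × ({c : PBond (F.P p.K) (k + 1) // c ∉ (Set.toFinite (bondsIn (k + 1) (s'.Ω (k + 1))ᶜ)).toFinset} → SU N)) × ((↥(Set.toFinite (bondsIn k ((s'.Λ (k + 1))ᶜ ∩ s'.Ω (k + 1)))).toFinset → V) × X₂) → ℝ≥0} (hJ : Measurable J) {S : Set ((↥(Set.toFinite (bondsIn k (s'.Ω (k + 1))ᶜ)).toFinset → SU N) × ({b : PBond (F.P p.K) k // b ∉ (Set.toFinite (bondsIn k (s'.Ω (k + 1))ᶜ)).toFinset} → SU N))}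
    (hpush : ((((Measure.pi fun _ : ↥(Set.toFinite (bondsIn k (s'.Ω (k + 1))ᶜ)).toFinset => (HaarData.haar : Measure (SU N))).prod
          (Measure.pi fun _ : {c : PBond (F.P p.K) (k + 1) // c ∉ (Set.toFinite (bondsIn (k + 1) (s'.Ω (k + 1))ᶜ)).toFinset} =>
            (HaarData.haar : Measure (SU N)))) ⊗ₘ (Kernel.const _ (Measure.pi fun _ : ↥(Set.toFinite (bondsIn k ((s'.Λ (k + 1))ᶜ ∩ s'.Ω (k + 1)))).toFinset => (volume : Measure V)) ⊗ₖ κ₂)).withDensity (fun z => (J z : ℝ≥0∞))).map Ψ =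
      (((Measure.pi fun _ : ↥(Set.toFinite (bondsIn k (s'.Ω (k + 1))ᶜ)).toFinset => (HaarData.haar : Measure (SU N))).prod
          (Measure.pi fun _ : {b : PBond (F.P p.K) k // b ∉ (Set.toFinite (bondsIn k (s'.Ω (k + 1))ᶜ)).toFinset} => (HaarData.haar : Measure (SU N))))).restrict S)
    (hfib : ∀ᵐ z ∂((((Measure.pi fun _ : ↥(Set.toFinite (bondsIn k (s'.Ω (k + 1))ᶜ)).toFinset => (HaarData.haar : Measure (SU N))).prod
          (Measure.pi fun _ : {c : PBond (F.P p.K) (k + 1) // c ∉ (Set.toFinite (bondsIn (k + 1) (s'.Ω (k + 1))ᶜ)).toFinset} =>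
            (HaarData.haar : Measure (SU N)))) ⊗ₘ (Kernel.const _ (Measure.pi fun _ : ↥(Set.toFinite (bondsIn k ((s'.Λ (k + 1))ᶜ ∩ s'.Ω (k + 1)))).toFinset => (volume : Measure V)) ⊗ₖ κ₂)).withDensity (fun z => (J z : ℝ≥0∞))),
      (fun q => (q.1, fun c : {c : PBond (F.P p.K) (k + 1) // c ∉ (Set.toFinite (bondsIn (k + 1) (s'.Ω (k + 1))ᶜ)).toFinset} =>
          (avOfRecord F N p.K k).avg
            ((MeasurableEquiv.piEquivPiSubtypeProd (fun _ : PBond (F.P p.K) k => SU N)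
              (· ∈ (Set.toFinite (bondsIn k (s'.Ω (k + 1))ᶜ)).toFinset)).symm q) c)) (Ψ z) = z.1)
    (hwS : ∀ q : (↥(Set.toFinite (bondsIn k (s'.Ω (k + 1))ᶜ)).toFinset → SU N) × ({b : PBond (F.P p.K) k // b ∉ (Set.toFinite (bondsIn k (s'.Ω (k + 1))ᶜ)).toFinset} → SU N), q ∉ S →
      w p g k s' (⇑(MeasurableEquiv.piEquivPiSubtypeProd (fun _ : PBond (F.P p.K) k => SU N)
            (· ∈ (Set.toFinite (bondsIn k (s'.Ω (k + 1))ᶜ)).toFinset)).symm q) ((avOfRecord F N p.K k).avg (⇑(MeasurableEquiv.piEquivPiSubtypeProd (fun _ : PBond (F.P p.K) k => SU N)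
            (· ∈ (Set.toFinite (bondsIn k (s'.Ω (k + 1))ᶜ)).toFinset)).symm q)) = 0)
    (hwm : Measurable fun U => w p g k s' U ((avOfRecord F N p.K k).avg U)) (hχm : Measurable (chiSeqOfRecord F N ν τ.M g p.K k s'.init))
    (hζm : ∀ j Y, Measurable (W₀.ζ j Y)) (hwWm : ∀ j Λ' Y S, Measurable (W₀.w j Λ' Y S))
    (hΦ₀m : ∀ S₀ ∈ admSOfRecord F ν τ.M g p.K k s'.init,
      Measurable fun ω : MultiCfg (F.P p.K) (SU N) V => Φ₀ (S₀, fun j => (ω j).2) (fun j => (ω j).1))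
    (hint : ∀ᵐ q ∂((Measure.pi fun _ : ↥(Set.toFinite (bondsIn (k + 1) (s'.Ω (k + 1))ᶜ)).toFinset => (HaarData.haar : Measure (SU N))).prod
          (Measure.pi fun _ : {c : PBond (F.P p.K) (k + 1) // c ∉ (Set.toFinite (bondsIn (k + 1) (s'.Ω (k + 1))ᶜ)).toFinset} =>
            (HaarData.haar : Measure (SU N)))),
      ∀ S ∈ admSOfRecord F ν τ.M g p.K (k + 1) s', Integrable
        (fun y : ↥(Set.toFinite (bondsIn k (s'.Ω (k + 1))ᶜ)).toFinset → SU N =>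
          zetaOp (genDataOfRecord F N V ν τ.M g p.K W s' S k).ζ
            (aOp k (genDataOfRecord F N V ν τ.M g p.K W s' S k).sA (genDataOfRecord F N V ν τ.M g p.K W s' S k).w
              (tkBranchOfRecord F N V ν τ.M g p.K W s' S k (fun ω => Φ (S, fun j => (ω j).2) (fun j => (ω j).1))))
            (Function.update (baseCfg (k + 1) ((MeasurableEquiv.piEquivPiSubtypeProd (fun _ : PBond (F.P p.K) (k + 1) => SU N)
                (· ∈ (Set.toFinite (bondsIn (k + 1) (s'.Ω (k + 1))ᶜ)).toFinset)).symm q)) k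
              (Function.updateFinset ((baseCfg (V := V) (k + 1) ((MeasurableEquiv.piEquivPiSubtypeProd (fun _ : PBond (F.P p.K) (k + 1) => SU N)
                (· ∈ (Set.toFinite (bondsIn (k + 1) (s'.Ω (k + 1))ᶜ)).toFinset)).symm q)) k).1 (Set.toFinite (bondsIn k (s'.Ω (k + 1))ᶜ)).toFinset y,
                ((baseCfg (V := V) (k + 1) ((MeasurableEquiv.piEquivPiSubtypeProd (fun _ : PBond (F.P p.K) (k + 1) => SU N)
                (· ∈ (Set.toFinite (bondsIn (k + 1) (s'.Ω (k + 1))ᶜ)).toFinset)).symm q)) k).2)))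
        (condLaw (Measure.pi fun _ : ↥(Set.toFinite (bondsIn k (s'.Ω (k + 1))ᶜ)).toFinset => (HaarData.haar : Measure (SU N)))
          (avgRestrOfRecord F N p.K k (Set.toFinite (bondsIn k (s'.Ω (k + 1))ᶜ)).toFinset (Set.toFinite (bondsIn (k + 1) (s'.Ω (k + 1))ᶜ)).toFinset) q.1))
    -- (a.1) the charted old-branch piece is integrable on the product fibre at every inside fine `y` on the averaging fibre (Fubini's proviso)
    (hIslice : ∀ᵐ q ∂((Measure.pi fun _ : ↥(Set.toFinite (bondsIn (k + 1) (s'.Ω (k + 1))ᶜ)).toFinset => (HaarData.haar : Measure (SU N))).prod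
          (Measure.pi fun _ : {c : PBond (F.P p.K) (k + 1) // c ∉ (Set.toFinite (bondsIn (k + 1) (s'.Ω (k + 1))ᶜ)).toFinset} => (HaarData.haar : Measure (SU N)))),
      ∀ S₀ ∈ admSOfRecord F ν τ.M g p.K k s'.init, ∀ y : ↥(Set.toFinite (bondsIn k (s'.Ω (k + 1))ᶜ)).toFinset → SU N,
        avgRestrOfRecord F N p.K k (Set.toFinite (bondsIn k (s'.Ω (k + 1))ᶜ)).toFinset (Set.toFinite (bondsIn (k + 1) (s'.Ω (k + 1))ᶜ)).toFinset y = q.1 →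
        Integrable (fun x : ((↥(Set.toFinite (bondsIn k ((s'.Λ (k + 1))ᶜ ∩ s'.Ω (k + 1)))).toFinset → V) × X₂) => (J ((y, q.2), x) : ℝ) * ((fun U => w p g k s' U ((avOfRecord F N p.K k).avg U) *
        (chiSeqOfRecord F N ν τ.M g p.K k s'.init U *
          tkBranchOfRecord F N V ν τ.M g p.K W₀ s'.init S₀ k (fun ω => Φ₀ (S₀, fun j => (ω j).2) (fun j => (ω j).1)) (baseCfg k U))) ∘
          ⇑(MeasurableEquiv.piEquivPiSubtypeProd (fun _ : PBond (F.P p.K) k => SU N) (· ∈ (Set.toFinite (bondsIn k (s'.Ω (k + 1))ᶜ)).toFinset)).symm) (Ψ ((y, q.2), x))) ((Kernel.const _ (Measure.pi fun _ : ↥(Set.toFinite (bondsIn k ((s'.Λ (k + 1))ᶜ ∩ s'.Ω (k + 1)))).toFinset => (volume : Measure V)) ⊗ₖ κ₂) (y, q.2)))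
    -- 11a's laws of the NEW weights, nonnegativity of the NEW operand, measurability of the new weights' `ζ_j(Y)` ∕ `w_j(Λ′,Y,S)` and of the new operand at every branch
    (hW : W.Laws) (hΦ0 : ∀ a U, 0 ≤ Φ a U)
    (hζWm : ∀ j Y, Measurable (W.ζ j Y)) (hwWm' : ∀ j Λ' Y S, Measurable (W.w j Λ' Y S))
    (hΦm : ∀ S, Measurable fun ω : MultiCfg (F.P p.K) (SU N) V => Φ (S, fun j => (ω j).2) (fun j => (ω j).1))
    -- (b) THE PER-FLUCTUATION-SLICE IDENTITY ((3.23): the conditional `A_k|_{Λ_{k+1}}` integral of the charted old piece = ζ·χ·Gaussian weight·new operand) — displayed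
    (hslice : ∀ᵐ q ∂((Measure.pi fun _ : ↥(Set.toFinite (bondsIn (k + 1) (s'.Ω (k + 1))ᶜ)).toFinset => (HaarData.haar : Measure (SU N))).prod
          (Measure.pi fun _ : {c : PBond (F.P p.K) (k + 1) // c ∉ (Set.toFinite (bondsIn (k + 1) (s'.Ω (k + 1))ᶜ)).toFinset} => (HaarData.haar : Measure (SU N)))),
      ∀ S₀ ∈ admSOfRecord F ν τ.M g p.K k s'.init, ∀ y : ↥(Set.toFinite (bondsIn k (s'.Ω (k + 1))ᶜ)).toFinset → SU N,
        avgRestrOfRecord F N p.K k (Set.toFinite (bondsIn k (s'.Ω (k + 1))ᶜ)).toFinset (Set.toFinite (bondsIn (k + 1) (s'.Ω (k + 1))ᶜ)).toFinset y = q.1 →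
        ∀ᵐ a ∂(Measure.pi fun _ : ↥(Set.toFinite (bondsIn k ((s'.Λ (k + 1))ᶜ ∩ s'.Ω (k + 1)))).toFinset => (volume : Measure V)),
          ∫ x₂, (J ((y, q.2), (a, x₂)) : ℝ) * ((fun U => w p g k s' U ((avOfRecord F N p.K k).avg U) *
        (chiSeqOfRecord F N ν τ.M g p.K k s'.init U *
          tkBranchOfRecord F N V ν τ.M g p.K W₀ s'.init S₀ k (fun ω => Φ₀ (S₀, fun j => (ω j).2) (fun j => (ω j).1)) (baseCfg k U))) ∘
          ⇑(MeasurableEquiv.piEquivPiSubtypeProd (fun _ : PBond (F.P p.K) k => SU N) (· ∈ (Set.toFinite (bondsIn k (s'.Ω (k + 1))ᶜ)).toFinset)).symm) (Ψ ((y, q.2), (a, x₂))) ∂(κ₂ ((y, q.2), a)) =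
            W.ζ k (s'.Ω (k + 1))ᶜ
                (Function.update (baseCfg (k + 1) ((MeasurableEquiv.piEquivPiSubtypeProd (fun _ : PBond (F.P p.K) (k + 1) => SU N) (· ∈ (Set.toFinite (bondsIn (k + 1) (s'.Ω (k + 1))ᶜ)).toFinset)).symm q)) k (Function.updateFinset ((baseCfg (V := V) (k + 1) ((MeasurableEquiv.piEquivPiSubtypeProd (fun _ : PBond (F.P p.K) (k + 1) => SU N) (· ∈ (Set.toFinite (bondsIn (k + 1) (s'.Ω (k + 1))ᶜ)).toFinset)).symm q)) k).1 (Set.toFinite (bondsIn k (s'.Ω (k + 1))ᶜ)).toFinset y, ((baseCfg (V := V) (k + 1) ((MeasurableEquiv.piEquivPiSubtypeProd (fun _ : PBond (F.P p.K) (k + 1) => SU N) (· ∈ (Set.toFinite (bondsIn (k + 1) (s'.Ω (k + 1))ᶜ)).toFinset)).symm q)) k).2)) *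
              ∑ Y ∈ (Set.toFinite {Y : Set (Site (F.P p.K) 0) | Y ∈ SClassOfRecord F ν g p.K (k + 1) ∧ Y ⊆ s'.Ω (k + 1) ∩ (s'.Λ (k + 1))ᶜ}).toFinset,
                W.w k (s'.Λ (k + 1)) ((s'.Λ (k + 1))ᶜ ∩ s'.Ω (k + 1)) Y
                    (Function.update (Function.update (baseCfg (k + 1) ((MeasurableEquiv.piEquivPiSubtypeProd (fun _ : PBond (F.P p.K) (k + 1) => SU N) (· ∈ (Set.toFinite (bondsIn (k + 1) (s'.Ω (k + 1))ᶜ)).toFinset)).symm q)) k (Function.updateFinset ((baseCfg (V := V) (k + 1) ((MeasurableEquiv.piEquivPiSubtypeProd (fun _ : PBond (F.P p.K) (k + 1) => SU N) (· ∈ (Set.toFinite (bondsIn (k + 1) (s'.Ω (k + 1))ᶜ)).toFinset)).symm q)) k).1 (Set.toFinite (bondsIn k (s'.Ω (k + 1))ᶜ)).toFinset y, ((baseCfg (V := V) (k + 1) ((MeasurableEquiv.piEquivPiSubtypeProd (fun _ : PBond (F.P p.K) (k + 1) => SU N) (· ∈ (Set.toFinite (bondsIn (k + 1) (s'.Ω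 (k + 1))ᶜ)).toFinset)).symm q)) k).2)) k (insA (Set.toFinite (bondsIn k ((s'.Λ (k + 1))ᶜ ∩ s'.Ω (k + 1)))).toFinset a ((Function.update (baseCfg (k + 1) ((MeasurableEquiv.piEquivPiSubtypeProd (fun _ : PBond (F.P p.K) (k + 1) => SU N) (· ∈ (Set.toFinite (bondsIn (k + 1) (s'.Ω (k + 1))ᶜ)).toFinset)).symm q)) k (Function.updateFinset ((baseCfg (V := V) (k + 1) ((MeasurableEquiv.piEquivPiSubtypeProd (fun _ : PBond (F.P p.K) (k + 1) => SU N) (· ∈ (Set.toFinite (bondsIn (k + 1) (s'.Ω (k + 1))ᶜ)).toFinset)).symm q)) k).1 (Set.toFinite (bondsIn k (s'.Ω (k + 1))ᶜ)).toFinset y, ((baseCfg (V := V) (k + 1) ((MeasurableEquiv.piEquivPiSubtypeProd (fun _ : PBond (F.P p.K) (k + 1) => SU N) (· ∈ (Set.toFinite (bondsIn (k + 1) (s'.Ω (k + 1))ᶜ)).toFinset)).symm q)) k).2)) k))) *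
                tkBranchOfRecord F N V ν τ.M g p.K W s'.init S₀ k
              (fun ω => Φ (Function.update S₀ (k + 1) Y, fun j => (ω j).2) (fun j => (ω j).1))
                    (Function.update (Function.update (baseCfg (k + 1) ((MeasurableEquiv.piEquivPiSubtypeProd (fun _ : PBond (F.P p.K) (k + 1) => SU N) (· ∈ (Set.toFinite (bondsIn (k + 1) (s'.Ω (k + 1))ᶜ)).toFinset)).symm q)) k (Function.updateFinset ((baseCfg (V := V) (k + 1) ((MeasurableEquiv.piEquivPiSubtypeProd (fun _ : PBond (F.P p.K) (k + 1) => SU N) (· ∈ (Set.toFinite (bondsIn (k + 1) (s'.Ω (k + 1))ᶜ)).toFinset)).symm q)) k).1 (Set.toFinite (bondsIn k (s'.Ω (k + 1))ᶜ)).toFinset y, ((baseCfg (V := V) (k + 1) ((MeasurableEquiv.piEquivPiSubtypeProd (fun _ : PBond (F.P p.K) (k + 1) => SU N) (· ∈ (Set.toFinite (bondsIn (k + 1) (s'.Ω (k + 1))ᶜ)).toFinset)).symm q)) k).2)) k (insA (Set.toFinite (bondsIn k ((s'.Λ (k + 1))ᶜ ∩ s'.Ω (k + 1)))).toFinset a ((Function.update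 (baseCfg (k + 1) ((MeasurableEquiv.piEquivPiSubtypeProd (fun _ : PBond (F.P p.K) (k + 1) => SU N) (· ∈ (Set.toFinite (bondsIn (k + 1) (s'.Ω (k + 1))ᶜ)).toFinset)).symm q)) k (Function.updateFinset ((baseCfg (V := V) (k + 1) ((MeasurableEquiv.piEquivPiSubtypeProd (fun _ : PBond (F.P p.K) (k + 1) => SU N) (· ∈ (Set.toFinite (bondsIn (k + 1) (s'.Ω (k + 1))ᶜ)).toFinset)).symm q)) k).1 (Set.toFinite (bondsIn k (s'.Ω (k + 1))ᶜ)).toFinset y, ((baseCfg (V := V) (k + 1) ((MeasurableEquiv.piEquivPiSubtypeProd (fun _ : PBond (F.P p.K) (k + 1) => SU N) (· ∈ (Set.toFinite (bondsIn (k + 1) (s'.Ω (k + 1))ᶜ)).toFinset)).symm q)) k).2)) k)))) :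
    slotsTOfRecord F N ν τ E w ppSel p g (k + 1) s' =ᵐ[fieldMeasure (F.P p.K) (k + 1) (SU N)] TkOfRecord F N V ν τ.M g p.K W (k + 1) s' Φ := by
  refine slotsTOfRecord_succ_ae_eq_TkOfRecord_succ_of_oldBranchInnerChart ν τ E w ppSel p g hkK (hdec := hdec) (hdec' := hdec') hk s' W₀ W Φ₀ Φ
    hform hG₀ (Kernel.const _ (Measure.pi fun _ : ↥(Set.toFinite (bondsIn k ((s'.Λ (k + 1))ᶜ ∩ s'.Ω (k + 1)))).toFinset => (volume : Measure V)) ⊗ₖ κ₂) hΨ hJ hpush hfib hwS hwm hχm hζm hwWm hΦ₀m hint ?_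
  filter_upwards [hIslice, hslice] with q hqI hqS S₀ h₀ y hy
  -- the slice map `a ↦ ω_(y,a)` is measurable, the new weights ∕ branch operator are measurable and nonnegative
  have hupd : Measurable fun a : ↥(Set.toFinite (bondsIn k ((s'.Λ (k + 1))ᶜ ∩ s'.Ω (k + 1)))).toFinset → V =>
      Function.update (Function.update (baseCfg (k + 1) ((MeasurableEquiv.piEquivPiSubtypeProd (fun _ : PBond (F.P p.K) (k + 1) => SU N) (· ∈ (Set.toFinite (bondsIn (k + 1) (s'.Ω (k + 1))ᶜ)).toFinset)).symm q)) k (Function.updateFinset ((baseCfg (V := V) (k + 1) ((MeasurableEquiv.piEquivPiSubtypeProd (fun _ : PBond (F.P p.K) (k + 1) => SU N) (· ∈ (Set.toFinite (bondsIn (k + 1) (s'.Ω (k + 1))ᶜ)).toFinset)).symm q)) k).1 (Set.toFinite (bondsIn k (s'.Ω (k + 1))ᶜ)).toFinset y, ((baseCfg (V := V) (k + 1) ((MeasurableEquiv.piEquivPiSubtypeProd (fun _ : PBond (F.P p.K) (k + 1) => SU N) (· ∈ (Set.toFinite (bondsIn (k + 1) (s'.Ω (k + 1))ᶜ)).toFinset)).symm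 q)) k).2)) k
        (insA (Set.toFinite (bondsIn k ((s'.Λ (k + 1))ᶜ ∩ s'.Ω (k + 1)))).toFinset a
          ((Function.update (baseCfg (k + 1) ((MeasurableEquiv.piEquivPiSubtypeProd (fun _ : PBond (F.P p.K) (k + 1) => SU N) (· ∈ (Set.toFinite (bondsIn (k + 1) (s'.Ω (k + 1))ᶜ)).toFinset)).symm q)) k (Function.updateFinset ((baseCfg (V := V) (k + 1) ((MeasurableEquiv.piEquivPiSubtypeProd (fun _ : PBond (F.P p.K) (k + 1) => SU N) (· ∈ (Set.toFinite (bondsIn (k + 1) (s'.Ω (k + 1))ᶜ)).toFinset)).symm q)) k).1 (Set.toFinite (bondsIn k (s'.Ω (k + 1))ᶜ)).toFinset y, ((baseCfg (V := V) (k + 1) ((MeasurableEquiv.piEquivPiSubtypeProd (fun _ : PBond (F.P p.K) (k + 1) => SU N) (· ∈ (Set.toFinite (bondsIn (k + 1) (s'.Ω (k + 1))ᶜ)).toFinset)).symm q)) k).2)) k)) :=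
    (measurable_update _).comp (measurable_const.prodMk measurable_updateFinset)
  have hTm : ∀ Y : Set (Site (F.P p.K) 0), Measurable (tkBranchOfRecord F N V ν τ.M g p.K W s'.init S₀ k
      (fun ω => Φ (Function.update S₀ (k + 1) Y, fun j => (ω j).2) (fun j => (ω j).1))) := fun Y => by
    unfold tkBranchOfRecord
    exact measurable_tkOp _ (fun j Ψ' hΨ' => measurable_genOp_genDataOfRecord F N V ν τ.M g p.K W s'.init S₀ j (hζWm j _) (hwWm' j _ _ _) hΨ') k (hΦm _)
  have hupdS : ∀ Y : Set (Site (F.P p.K) 0), Function.update S₀ (k + 1) Y (k + 1) = Y := fun Y => Function.update_self _ _ _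
  simp only [zetaOp_apply, aOp_apply, genDataOfRecord_zeta, genDataOfRecord_sA, genDataOfRecord_w, hupdS]
  refine integral_compProd_const_eq_sum_mul_integral_of_nonneg_slices _ κ₂ _ (hqI S₀ h₀ y hy) _ _ ?_ ?_ (hqS S₀ h₀ y hy)
  · intro Y _ a
    exact mul_nonneg (TkWeights.w_nonneg hW k _ _ _ _) (tkBranchOfRecord_nonneg ν τ.M g p.K hW s'.init S₀ k (fun ω => hΦ0 _ _) _)
  · intro Y _
    exact ((hwWm' k _ _ Y).comp hupd).mul ((hTm Y).comp hupd)

end Slices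

/-! ## §3  The Stage-13 (O3′) edition under `zhLaws` and the operand's positivity -/

section Record13

open scoped Matrix.Norms.L2Operator

variable {F : T4Family} {N : ℕ} [NeZero N]

/-- ★★★★★★★ **THE (O3′) DISJUNCTION AT A v1.7 PARAMETER, INSIDE STEP AT A FLUCTUATION-PRODUCT SOCKET, UNDER `zhLaws`** — G′ (p633779 §3) with (hYint) REPLACED by measurability of the
NEW history's `ζ0_j(Y)` ∕ `quad_j(Λ′)` and of the new operand at every branch (11a's laws from `zhLaws` by `WtOfRecord₁₃H_laws`, positivity by `sect2Operand_pos`): THE (O3′) DISJUNCTION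
of `…N11Sect3SupplyChainDefs.PresentChildObligations` VERBATIM for the proposed `(t′, E′)`.  PROOF: G's three lines over §2.
[cite: Balaban1988Convergent, Thm 1 p.262, Thm 2 p.263, §3 p.279, (3.23)–(3.25) p.270, (2.18) p.257, (2.20)–(2.21) p.258, (3.1) p.264; Balaban1987RG1, (0.4) p.253, §2 p.267] -/
theorem slotsTOfRecord₁₃H_succ_O3_of_hasSect2FormAtZS_of_fluctuationSlices_of_weightLaws (θ : Stage13HParams F N) (p : B12.RunParams) {k : ℕ} (hkK : k < p.K)
    {hdec : DecidableEq (PBond (F.P p.K) k)} {hdec' : DecidableEq (PBond (F.P p.K) (k + 1))} (hk : k + 1 ≤ (F.P p.K).m + (F.P p.K).K)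
    (s' : SeqOfRecord F θ.ν θ.τ9.M (gOfRecord₁₃ F N θ.toStage13Params p) p.K (k + 1))
    {law : SeqOfRecord F θ.ν θ.τ9.M (gOfRecord₁₃ F N θ.toStage13Params p) p.K k → Sect2.TermValues (F.P p.K) (MatA N) (FluctV N) θ.τ9.M → Prop}
    {t : SeqOfRecord F θ.ν θ.τ9.M (gOfRecord₁₃ F N θ.toStage13Params p) p.K k → Sect2.TermValues (F.P p.K) (MatA N) (FluctV N) θ.τ9.M}
    {Ek : SeqOfRecord F θ.ν θ.τ9.M (gOfRecord₁₃ F N θ.toStage13Params p) p.K k → ℝ}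
    (hform : HasSect2FormAtZS F N (FluctV N) p.K (settingOfRecord₁₃ F N θ.toStage13Params p) k (θ.rzAt p) (WtOfRecord₁₃H F N θ p)
      (UbgOfRecord₁₃CoP F N θ.toStage13Params p k) law
      (slotsOfRecord F N θ.ν θ.τ9 (EOfRecord₁₃ F N θ.toStage13Params) (wOfRecord₉ F N θ.toStage9Params) θ.ppSel p (gOfRecord₁₃ F N θ.toStage13Params p) k) t Ek)
    (t' : Sect2.TermValues (F.P p.K) (MatA N) (FluctV N) θ.τ9.M) (E' : ℝ)
    -- def-T's graph integrability of the step + the residual law + nonnegativity ∕ measurability rows (dag-n11-e's `ResidualRowsAt` ∕ `OperandRowsAt` shapes)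
    (hG : Integrable (fun U => wOfRecord₉ F N θ.toStage9Params p (gOfRecord₁₃ F N θ.toStage13Params p) k s' U ((avOfRecord F N p.K k).avg U) *
      (chiSeqOfRecord F N θ.ν θ.τ9.M (gOfRecord₁₃ F N θ.toStage13Params p) p.K k s'.init U *
        slotsOfRecord F N θ.ν θ.τ9 (EOfRecord₁₃ F N θ.toStage13Params) (wOfRecord₉ F N θ.toStage9Params) θ.ppSel p (gOfRecord₁₃ F N θ.toStage13Params p) k s'.init U))
      (fieldMeasure (F.P p.K) k (SU N)))
    (hZ : ∀ p n Ω Λ, (θ.Zh p n Ω Λ).Laws)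
    (hw0 : ∀ U, 0 ≤ wOfRecord₉ F N θ.toStage9Params p (gOfRecord₁₃ F N θ.toStage13Params p) k s' U ((avOfRecord F N p.K k).avg U))
    (hwm : Measurable fun U => wOfRecord₉ F N θ.toStage9Params p (gOfRecord₁₃ F N θ.toStage13Params p) k s' U ((avOfRecord F N p.K k).avg U))
    (hχm : Measurable fun U => chiSeqOfRecord F N θ.ν θ.τ9.M (gOfRecord₁₃ F N θ.toStage13Params p) p.K k s'.init U)
    (hζ0m : ∀ j Y, Measurable ((θ.zhAt p s'.init).ζ0 j Y)) (hqm : ∀ j Λ', Measurable ((θ.zhAt p s'.init).quad j Λ'))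
    (hΦ₀m : ∀ S₀ ∈ admSOfRecord F θ.ν θ.τ9.M (gOfRecord₁₃ F N θ.toStage13Params p) p.K k s'.init,
      Measurable fun ω : MultiCfg (F.P p.K) (SU N) (FluctV N) =>
        (sect2Operand F N (FluctV N) p.K (settingOfRecord₁₃ F N θ.toStage13Params p) (θ.rzAt p s'.init) s'.init (t s'.init) (Ek s'.init)
            (UbgOfRecord₁₃CoP F N θ.toStage13Params p k s'.init)) (S₀, fun j => (ω j).2) (fun j => (ω j).1))
    {X₂ : Type*} [MeasurableSpace X₂] (κ₂ : Kernel (((↥(Set.toFinite (bondsIn k (s'.Ω (k + 1))ᶜ)).toFinset → SU N) × ({c : PBond (F.P p.K) (k + 1) // c ∉ (Set.toFinite (bondsIn (k + 1) (s'.Ω (k + 1))ᶜ)).toFinset} → SU N)) × (↥(Set.toFinite (bondsIn k ((s'.Λ (k + 1))ᶜ ∩ s'.Ω (k + 1)))).toFinset → FluctV N)) X₂) [IsSFiniteKernel κ₂]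
    {Ψ : ((↥(Set.toFinite (bondsIn k (s'.Ω (k + 1))ᶜ)).toFinset → SU N) × ({c : PBond (F.P p.K) (k + 1) // c ∉ (Set.toFinite (bondsIn (k + 1) (s'.Ω (k + 1))ᶜ)).toFinset} → SU N)) × ((↥(Set.toFinite (bondsIn k ((s'.Λ (k + 1))ᶜ ∩ s'.Ω (k + 1)))).toFinset → FluctV N) × X₂) → (↥(Set.toFinite (bondsIn k (s'.Ω (k + 1))ᶜ)).toFinset → SU N) × ({b : PBond (F.P p.K) k // b ∉ (Set.toFinite (bondsIn k (s'.Ω (k + 1))ᶜ)).toFinset} → SU N)} (hΨ : Measurable Ψ)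
    {J : ((↥(Set.toFinite (bondsIn k (s'.Ω (k + 1))ᶜ)).toFinset → SU N) × ({c : PBond (F.P p.K) (k + 1) // c ∉ (Set.toFinite (bondsIn (k + 1) (s'.Ω (k + 1))ᶜ)).toFinset} → SU N)) × ((↥(Set.toFinite (bondsIn k ((s'.Λ (k + 1))ᶜ ∩ s'.Ω (k + 1)))).toFinset → FluctV N) × X₂) → ℝ≥0} (hJ : Measurable J) {S : Set ((↥(Set.toFinite (bondsIn k (s'.Ω (k + 1))ᶜ)).toFinset → SU N) × ({b : PBond (F.P p.K) k // b ∉ (Set.toFinite (bondsIn k (s'.Ω (k + 1))ᶜ)).toFinset} → SU N))}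
    (hpush : ((((Measure.pi fun _ : ↥(Set.toFinite (bondsIn k (s'.Ω (k + 1))ᶜ)).toFinset => (HaarData.haar : Measure (SU N))).prod
          (Measure.pi fun _ : {c : PBond (F.P p.K) (k + 1) // c ∉ (Set.toFinite (bondsIn (k + 1) (s'.Ω (k + 1))ᶜ)).toFinset} =>
            (HaarData.haar : Measure (SU N)))) ⊗ₘ (Kernel.const _ (Measure.pi fun _ : ↥(Set.toFinite (bondsIn k ((s'.Λ (k + 1))ᶜ ∩ s'.Ω (k + 1)))).toFinset => (volume : Measure (FluctV N))) ⊗ₖ κ₂)).withDensity (fun z => (J z : ℝ≥0∞))).map Ψ =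
      (((Measure.pi fun _ : ↥(Set.toFinite (bondsIn k (s'.Ω (k + 1))ᶜ)).toFinset => (HaarData.haar : Measure (SU N))).prod
          (Measure.pi fun _ : {b : PBond (F.P p.K) k // b ∉ (Set.toFinite (bondsIn k (s'.Ω (k + 1))ᶜ)).toFinset} => (HaarData.haar : Measure (SU N))))).restrict S)
    (hfib : ∀ᵐ z ∂((((Measure.pi fun _ : ↥(Set.toFinite (bondsIn k (s'.Ω (k + 1))ᶜ)).toFinset => (HaarData.haar : Measure (SU N))).prod
          (Measure.pi fun _ : {c : PBond (F.P p.K) (k + 1) // c ∉ (Set.toFinite (bondsIn (k + 1) (s'.Ω (k + 1))ᶜ)).toFinset} =>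
            (HaarData.haar : Measure (SU N)))) ⊗ₘ (Kernel.const _ (Measure.pi fun _ : ↥(Set.toFinite (bondsIn k ((s'.Λ (k + 1))ᶜ ∩ s'.Ω (k + 1)))).toFinset => (volume : Measure (FluctV N))) ⊗ₖ κ₂)).withDensity (fun z => (J z : ℝ≥0∞))),
      (fun q => (q.1, fun c : {c : PBond (F.P p.K) (k + 1) // c ∉ (Set.toFinite (bondsIn (k + 1) (s'.Ω (k + 1))ᶜ)).toFinset} =>
          (avOfRecord F N p.K k).avg
            ((MeasurableEquiv.piEquivPiSubtypeProd (fun _ : PBond (F.P p.K) k => SU N)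
              (· ∈ (Set.toFinite (bondsIn k (s'.Ω (k + 1))ᶜ)).toFinset)).symm q) c)) (Ψ z) = z.1)
    (hwS : ∀ q : (↥(Set.toFinite (bondsIn k (s'.Ω (k + 1))ᶜ)).toFinset → SU N) × ({b : PBond (F.P p.K) k // b ∉ (Set.toFinite (bondsIn k (s'.Ω (k + 1))ᶜ)).toFinset} → SU N), q ∉ S →
      wOfRecord₉ F N θ.toStage9Params p (gOfRecord₁₃ F N θ.toStage13Params p) k s' (⇑(MeasurableEquiv.piEquivPiSubtypeProd (fun _ : PBond (F.P p.K) k => SU N)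
            (· ∈ (Set.toFinite (bondsIn k (s'.Ω (k + 1))ᶜ)).toFinset)).symm q) ((avOfRecord F N p.K k).avg (⇑(MeasurableEquiv.piEquivPiSubtypeProd (fun _ : PBond (F.P p.K) k => SU N)
            (· ∈ (Set.toFinite (bondsIn k (s'.Ω (k + 1))ᶜ)).toFinset)).symm q)) = 0)
    -- the conditional-integrability row of the NEW inside integrands
    (hint : ∀ᵐ q ∂((Measure.pi fun _ : ↥(Set.toFinite (bondsIn (k + 1) (s'.Ω (k + 1))ᶜ)).toFinset => (HaarData.haar : Measure (SU N))).prod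
          (Measure.pi fun _ : {c : PBond (F.P p.K) (k + 1) // c ∉ (Set.toFinite (bondsIn (k + 1) (s'.Ω (k + 1))ᶜ)).toFinset} =>
            (HaarData.haar : Measure (SU N)))),
      ∀ S ∈ admSOfRecord F θ.ν θ.τ9.M (gOfRecord₁₃ F N θ.toStage13Params p) p.K (k + 1) s', Integrable
        (fun y : ↥(Set.toFinite (bondsIn k (s'.Ω (k + 1))ᶜ)).toFinset → SU N =>
          zetaOp (genDataOfRecord F N (FluctV N) θ.ν θ.τ9.M (gOfRecord₁₃ F N θ.toStage13Params p) p.K (WtOfRecord₁₃H F N θ p s') s' S k).ζ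
            (aOp k (genDataOfRecord F N (FluctV N) θ.ν θ.τ9.M (gOfRecord₁₃ F N θ.toStage13Params p) p.K (WtOfRecord₁₃H F N θ p s') s' S k).sA
              (genDataOfRecord F N (FluctV N) θ.ν θ.τ9.M (gOfRecord₁₃ F N θ.toStage13Params p) p.K (WtOfRecord₁₃H F N θ p s') s' S k).w
              (tkBranchOfRecord F N (FluctV N) θ.ν θ.τ9.M (gOfRecord₁₃ F N θ.toStage13Params p) p.K (WtOfRecord₁₃H F N θ p s') s' S k
                (fun ω => (sect2Operand F N (FluctV N) p.K (settingOfRecord₁₃ F N θ.toStage13Params p) (θ.rzAt p s') s' t' E'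
                  (UbgOfRecord₁₃CoP F N θ.toStage13Params p (k + 1) s')) (S, fun j => (ω j).2) (fun j => (ω j).1))))
            (Function.update (baseCfg (k + 1) ((MeasurableEquiv.piEquivPiSubtypeProd (fun _ : PBond (F.P p.K) (k + 1) => SU N)
                (· ∈ (Set.toFinite (bondsIn (k + 1) (s'.Ω (k + 1))ᶜ)).toFinset)).symm q)) k
              (Function.updateFinset ((baseCfg (V := FluctV N) (k + 1) ((MeasurableEquiv.piEquivPiSubtypeProd (fun _ : PBond (F.P p.K) (k + 1) => SU N)
                (· ∈ (Set.toFinite (bondsIn (k + 1) (s'.Ω (k + 1))ᶜ)).toFinset)).symm q)) k).1 (Set.toFinite (bondsIn k (s'.Ω (k + 1))ᶜ)).toFinset y,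
                ((baseCfg (V := FluctV N) (k + 1) ((MeasurableEquiv.piEquivPiSubtypeProd (fun _ : PBond (F.P p.K) (k + 1) => SU N)
                (· ∈ (Set.toFinite (bondsIn (k + 1) (s'.Ω (k + 1))ᶜ)).toFinset)).symm q)) k).2)))
        (condLaw (Measure.pi fun _ : ↥(Set.toFinite (bondsIn k (s'.Ω (k + 1))ᶜ)).toFinset => (HaarData.haar : Measure (SU N)))
          (avgRestrOfRecord F N p.K k (Set.toFinite (bondsIn k (s'.Ω (k + 1))ᶜ)).toFinset (Set.toFinite (bondsIn (k + 1) (s'.Ω (k + 1))ᶜ)).toFinset) q.1))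
    -- (a.1) the charted old-branch piece is integrable on the product fibre at every inside fine `y` on the averaging fibre (Fubini's proviso)
    (hIslice : ∀ᵐ q ∂((Measure.pi fun _ : ↥(Set.toFinite (bondsIn (k + 1) (s'.Ω (k + 1))ᶜ)).toFinset => (HaarData.haar : Measure (SU N))).prod
          (Measure.pi fun _ : {c : PBond (F.P p.K) (k + 1) // c ∉ (Set.toFinite (bondsIn (k + 1) (s'.Ω (k + 1))ᶜ)).toFinset} => (HaarData.haar : Measure (SU N)))),
      ∀ S₀ ∈ admSOfRecord F θ.ν θ.τ9.M (gOfRecord₁₃ F N θ.toStage13Params p) p.K k s'.init, ∀ y : ↥(Set.toFinite (bondsIn k (s'.Ω (k + 1))ᶜ)).toFinset → SU N,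
        avgRestrOfRecord F N p.K k (Set.toFinite (bondsIn k (s'.Ω (k + 1))ᶜ)).toFinset (Set.toFinite (bondsIn (k + 1) (s'.Ω (k + 1))ᶜ)).toFinset y = q.1 →
        Integrable (fun x : ((↥(Set.toFinite (bondsIn k ((s'.Λ (k + 1))ᶜ ∩ s'.Ω (k + 1)))).toFinset → FluctV N) × X₂) => (J ((y, q.2), x) : ℝ) * ((fun U => wOfRecord₉ F N θ.toStage9Params p (gOfRecord₁₃ F N θ.toStage13Params p) k s' U ((avOfRecord F N p.K k).avg U) *
        (chiSeqOfRecord F N θ.ν θ.τ9.M (gOfRecord₁₃ F N θ.toStage13Params p) p.K k s'.init U *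
          tkBranchOfRecord F N (FluctV N) θ.ν θ.τ9.M (gOfRecord₁₃ F N θ.toStage13Params p) p.K (WtOfRecord₁₃H F N θ p s'.init) s'.init S₀ k (fun ω => (sect2Operand F N (FluctV N) p.K (settingOfRecord₁₃ F N θ.toStage13Params p) (θ.rzAt p s'.init) s'.init (t s'.init) (Ek s'.init)
            (UbgOfRecord₁₃CoP F N θ.toStage13Params p k s'.init)) (S₀, fun j => (ω j).2) (fun j => (ω j).1)) (baseCfg k U))) ∘
          ⇑(MeasurableEquiv.piEquivPiSubtypeProd (fun _ : PBond (F.P p.K) k => SU N) (· ∈ (Set.toFinite (bondsIn k (s'.Ω (k + 1))ᶜ)).toFinset)).symm) (Ψ ((y, q.2), x))) ((Kernel.const _ (Measure.pi fun _ : ↥(Set.toFinite (bondsIn k ((s'.Λ (k + 1))ᶜ ∩ s'.Ω (k + 1)))).toFinset => (volume : Measure (FluctV N))) ⊗ₖ κ₂) (y, q.2)))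
    -- measurability of the NEW history's residual `ζ0_j(Y)` ∕ `quad_j(Λ′)` and of the NEW operand at every branch (laws and positivity come from `zhLaws` ∕ the exponential)
    (hζ0m' : ∀ j Y, Measurable ((θ.zhAt p s').ζ0 j Y)) (hqm' : ∀ j Λ', Measurable ((θ.zhAt p s').quad j Λ'))
    (hΦm : ∀ S, Measurable fun ω : MultiCfg (F.P p.K) (SU N) (FluctV N) =>
        (sect2Operand F N (FluctV N) p.K (settingOfRecord₁₃ F N θ.toStage13Params p) (θ.rzAt p s') s' t' E'
                  (UbgOfRecord₁₃CoP F N θ.toStage13Params p (k + 1) s')) (S, fun j => (ω j).2) (fun j => (ω j).1))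
    -- (b) THE PER-FLUCTUATION-SLICE IDENTITY ((3.23): the conditional `A_k|_{Λ_{k+1}}` integral of the charted old piece = ζ·χ·Gaussian weight·new operand) — displayed
    (hslice : ∀ᵐ q ∂((Measure.pi fun _ : ↥(Set.toFinite (bondsIn (k + 1) (s'.Ω (k + 1))ᶜ)).toFinset => (HaarData.haar : Measure (SU N))).prod
          (Measure.pi fun _ : {c : PBond (F.P p.K) (k + 1) // c ∉ (Set.toFinite (bondsIn (k + 1) (s'.Ω (k + 1))ᶜ)).toFinset} => (HaarData.haar : Measure (SU N)))),
      ∀ S₀ ∈ admSOfRecord F θ.ν θ.τ9.M (gOfRecord₁₃ F N θ.toStage13Params p) p.K k s'.init, ∀ y : ↥(Set.toFinite (bondsIn k (s'.Ω (k + 1))ᶜ)).toFinset → SU N,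
        avgRestrOfRecord F N p.K k (Set.toFinite (bondsIn k (s'.Ω (k + 1))ᶜ)).toFinset (Set.toFinite (bondsIn (k + 1) (s'.Ω (k + 1))ᶜ)).toFinset y = q.1 →
        ∀ᵐ a ∂(Measure.pi fun _ : ↥(Set.toFinite (bondsIn k ((s'.Λ (k + 1))ᶜ ∩ s'.Ω (k + 1)))).toFinset => (volume : Measure (FluctV N))),
          ∫ x₂, (J ((y, q.2), (a, x₂)) : ℝ) * ((fun U => wOfRecord₉ F N θ.toStage9Params p (gOfRecord₁₃ F N θ.toStage13Params p) k s' U ((avOfRecord F N p.K k).avg U) *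
        (chiSeqOfRecord F N θ.ν θ.τ9.M (gOfRecord₁₃ F N θ.toStage13Params p) p.K k s'.init U *
          tkBranchOfRecord F N (FluctV N) θ.ν θ.τ9.M (gOfRecord₁₃ F N θ.toStage13Params p) p.K (WtOfRecord₁₃H F N θ p s'.init) s'.init S₀ k (fun ω => (sect2Operand F N (FluctV N) p.K (settingOfRecord₁₃ F N θ.toStage13Params p) (θ.rzAt p s'.init) s'.init (t s'.init) (Ek s'.init)
            (UbgOfRecord₁₃CoP F N θ.toStage13Params p k s'.init)) (S₀, fun j => (ω j).2) (fun j => (ω j).1)) (baseCfg k U))) ∘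
          ⇑(MeasurableEquiv.piEquivPiSubtypeProd (fun _ : PBond (F.P p.K) k => SU N) (· ∈ (Set.toFinite (bondsIn k (s'.Ω (k + 1))ᶜ)).toFinset)).symm) (Ψ ((y, q.2), (a, x₂))) ∂(κ₂ ((y, q.2), a)) =
            (WtOfRecord₁₃H F N θ p s').ζ k (s'.Ω (k + 1))ᶜ
                (Function.update (baseCfg (k + 1) ((MeasurableEquiv.piEquivPiSubtypeProd (fun _ : PBond (F.P p.K) (k + 1) => SU N) (· ∈ (Set.toFinite (bondsIn (k + 1) (s'.Ω (k + 1))ᶜ)).toFinset)).symm q)) k (Function.updateFinset ((baseCfg (V := FluctV N) (k + 1) ((MeasurableEquiv.piEquivPiSubtypeProd (fun _ : PBond (F.P p.K) (k + 1) => SU N) (· ∈ (Set.toFinite (bondsIn (k + 1) (s'.Ω (k + 1))ᶜ)).toFinset)).symm q)) k).1 (Set.toFinite (bondsIn k (s'.Ω (k + 1))ᶜ)).toFinset y, ((baseCfg (V := FluctV N) (k + 1) ((MeasurableEquiv.piEquivPiSubtypeProd (fun _ : PBond (F.P p.K) (k + 1) => SU N) (· ∈ (Set.toFinite (bondsIn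 (k + 1) (s'.Ω (k + 1))ᶜ)).toFinset)).symm q)) k).2)) *
              ∑ Y ∈ (Set.toFinite {Y : Set (Site (F.P p.K) 0) | Y ∈ SClassOfRecord F θ.ν (gOfRecord₁₃ F N θ.toStage13Params p) p.K (k + 1) ∧ Y ⊆ s'.Ω (k + 1) ∩ (s'.Λ (k + 1))ᶜ}).toFinset,
                (WtOfRecord₁₃H F N θ p s').w k (s'.Λ (k + 1)) ((s'.Λ (k + 1))ᶜ ∩ s'.Ω (k + 1)) Y
                    (Function.update (Function.update (baseCfg (k + 1) ((MeasurableEquiv.piEquivPiSubtypeProd (fun _ : PBond (F.P p.K) (k + 1) => SU N) (· ∈ (Set.toFinite (bondsIn (k + 1) (s'.Ω (k + 1))ᶜ)).toFinset)).symm q)) k (Function.updateFinset ((baseCfg (V := FluctV N) (k + 1) ((MeasurableEquiv.piEquivPiSubtypeProd (fun _ : PBond (F.P p.K) (k + 1) => SU N) (· ∈ (Set.toFinite (bondsIn (k + 1) (s'.Ω (k + 1))ᶜ)).toFinset)).symm q)) k).1 (Set.toFinite (bondsIn k (s'.Ω (k + 1))ᶜ)).toFinset y, ((baseCfg (V :=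 FluctV N) (k + 1) ((MeasurableEquiv.piEquivPiSubtypeProd (fun _ : PBond (F.P p.K) (k + 1) => SU N) (· ∈ (Set.toFinite (bondsIn (k + 1) (s'.Ω (k + 1))ᶜ)).toFinset)).symm q)) k).2)) k (insA (Set.toFinite (bondsIn k ((s'.Λ (k + 1))ᶜ ∩ s'.Ω (k + 1)))).toFinset a ((Function.update (baseCfg (k + 1) ((MeasurableEquiv.piEquivPiSubtypeProd (fun _ : PBond (F.P p.K) (k + 1) => SU N) (· ∈ (Set.toFinite (bondsIn (k + 1) (s'.Ω (k + 1))ᶜ)).toFinset)).symm q)) k (Function.updateFinset ((baseCfg (V := FluctV N) (k + 1) ((MeasurableEquiv.piEquivPiSubtypeProd (fun _ : PBond (F.P p.K) (k + 1) => SU N) (· ∈ (Set.toFinite (bondsIn (k + 1) (s'.Ω (k + 1))ᶜ)).toFinset)).symm q)) k).1 (Set.toFinite (bondsIn k (s'.Ω (k + 1))ᶜ)).toFinset y, ((baseCfg (V := FluctV N) (k + 1) ((MeasurableEquiv.piEquivPiSubtypeProd (fun _ : PBond (F.P p.K) (k + 1) => SU N) (· ∈ (Set.toFinite (bondsIn (k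 + 1) (s'.Ω (k + 1))ᶜ)).toFinset)).symm q)) k).2)) k))) *
                tkBranchOfRecord F N (FluctV N) θ.ν θ.τ9.M (gOfRecord₁₃ F N θ.toStage13Params p) p.K (WtOfRecord₁₃H F N θ p s') s'.init S₀ k
              (fun ω => (sect2Operand F N (FluctV N) p.K (settingOfRecord₁₃ F N θ.toStage13Params p) (θ.rzAt p s') s' t' E'
                  (UbgOfRecord₁₃CoP F N θ.toStage13Params p (k + 1) s')) (Function.update S₀ (k + 1) Y, fun j => (ω j).2) (fun j => (ω j).1))
                    (Function.update (Function.update (baseCfg (k + 1) ((MeasurableEquiv.piEquivPiSubtypeProd (fun _ : PBond (F.P p.K) (k + 1) => SU N) (· ∈ (Set.toFinite (bondsIn (k + 1) (s'.Ω (k + 1))ᶜ)).toFinset)).symm q)) k (Function.updateFinset ((baseCfg (V := FluctV N) (k + 1) ((MeasurableEquiv.piEquivPiSubtypeProd (fun _ : PBond (F.P p.K) (k + 1) => SU N) (· ∈ (Set.toFinite (bondsIn (k + 1) (s'.Ω (k + 1))ᶜ)).toFinset)).symm q)) k).1 (Set.toFinite (bondsIn k (s'.Ω (k + 1))ᶜ)).toFinset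 y, ((baseCfg (V := FluctV N) (k + 1) ((MeasurableEquiv.piEquivPiSubtypeProd (fun _ : PBond (F.P p.K) (k + 1) => SU N) (· ∈ (Set.toFinite (bondsIn (k + 1) (s'.Ω (k + 1))ᶜ)).toFinset)).symm q)) k).2)) k (insA (Set.toFinite (bondsIn k ((s'.Λ (k + 1))ᶜ ∩ s'.Ω (k + 1)))).toFinset a ((Function.update (baseCfg (k + 1) ((MeasurableEquiv.piEquivPiSubtypeProd (fun _ : PBond (F.P p.K) (k + 1) => SU N) (· ∈ (Set.toFinite (bondsIn (k + 1) (s'.Ω (k + 1))ᶜ)).toFinset)).symm q)) k (Function.updateFinset ((baseCfg (V := FluctV N) (k + 1) ((MeasurableEquiv.piEquivPiSubtypeProd (fun _ : PBond (F.P p.K) (k + 1) => SU N) (· ∈ (Set.toFinite (bondsIn (k + 1) (s'.Ω (k + 1))ᶜ)).toFinset)).symm q)) k).1 (Set.toFinite (bondsIn k (s'.Ω (k + 1))ᶜ)).toFinset y, ((baseCfg (V := FluctV N) (k + 1) ((MeasurableEquiv.piEquivPiSubtypeProd (fun _ : PBond (F.P p.K) (k + 1) => SU N) (· ∈ (Set.toFinite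 (bondsIn (k + 1) (s'.Ω (k + 1))ᶜ)).toFinset)).symm q)) k).2)) k)))) :
    slotsTOfRecord F N θ.ν θ.τ9 (EOfRecord₁₃ F N θ.toStage13Params) (wOfRecord₉ F N θ.toStage9Params) θ.ppSel p (gOfRecord₁₃ F N θ.toStage13Params p) (k + 1) s' = 0 ∨
      ∀ᵐ V' ∂fieldMeasure (F.P p.K) (k + 1) (SU N),
        chiSeqOfRecord F N θ.ν θ.τ9.M (gOfRecord₁₃ F N θ.toStage13Params p) p.K (k + 1) s' V' ≠ 0 →
          slotsTOfRecord F N θ.ν θ.τ9 (EOfRecord₁₃ F N θ.toStage13Params) (wOfRecord₉ F N θ.toStage9Params) θ.ppSel p (gOfRecord₁₃ F N θ.toStage13Params p) (k + 1) s' V' =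
            sect2Slot F N (FluctV N) p.K (settingOfRecord₁₃ F N θ.toStage13Params p) (θ.rzAt p s') (WtOfRecord₁₃H F N θ p s') s' t' E'
              (UbgOfRecord₁₃CoP F N θ.toStage13Params p (k + 1) s') V' := by
  rcases (hform.2 s'.init).2 with h0 | hae
  · exact Or.inl (slotsTOfRecord_succ_eq_zero_of_init_eq_zero F N θ.ν θ.τ9 _ _ θ.ppSel p _ _ s' h0)
  · have hG₀ := integrable_oldBranch_pieces₁₃H_of_integrable_graph θ p s' t Ek hG hae hZ hw0 hwm hχm hζ0m hqm hΦ₀m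
    exact Or.inr ((slotsTOfRecord_succ_ae_eq_TkOfRecord_succ_of_oldBranchInnerChart_fluctuationSlices_of_weightLaws θ.ν θ.τ9 (EOfRecord₁₃ F N θ.toStage13Params)
      (wOfRecord₉ F N θ.toStage9Params) θ.ppSel p (gOfRecord₁₃ F N θ.toStage13Params p) hkK (hdec := hdec) (hdec' := hdec') hk s' (WtOfRecord₁₃H F N θ p s'.init) (WtOfRecord₁₃H F N θ p s')
      (sect2Operand F N (FluctV N) p.K (settingOfRecord₁₃ F N θ.toStage13Params p) (θ.rzAt p s'.init) s'.init (t s'.init) (Ek s'.init)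
            (UbgOfRecord₁₃CoP F N θ.toStage13Params p k s'.init))
      (sect2Operand F N (FluctV N) p.K (settingOfRecord₁₃ F N θ.toStage13Params p) (θ.rzAt p s') s' t' E'
                  (UbgOfRecord₁₃CoP F N θ.toStage13Params p (k + 1) s'))
      hae hG₀ κ₂ hΨ hJ hpush hfib hwS hwm hχm
      (fun j Y => measurable_tkWeightsOfRecordP_ζ F N (FluctV N) θ.ν θ.A₁ p (gOfRecord₁₃ F N θ.toStage13Params p) (θ.zhAt p s'.init) j Y (hζ0m j Y))
      (fun j Λ' Y S => measurable_tkWeightsOfRecordP_w F N (FluctV N) θ.ν θ.A₁ p (gOfRecord₁₃ F N θ.toStage13Params p) (θ.zhAt p s'.init) j Λ' Y S (hqm j Λ'))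
      hΦ₀m hint hIslice (WtOfRecord₁₃H_laws hZ p s') (fun a U => (sect2Operand_pos _ _ _ _ _ _ _ a U).le)
      (fun j Y => measurable_tkWeightsOfRecordP_ζ F N (FluctV N) θ.ν θ.A₁ p (gOfRecord₁₃ F N θ.toStage13Params p) (θ.zhAt p s') j Y (hζ0m' j Y))
      (fun j Λ' Y S => measurable_tkWeightsOfRecordP_w F N (FluctV N) θ.ν θ.A₁ p (gOfRecord₁₃ F N θ.toStage13Params p) (θ.zhAt p s') j Λ' Y S (hqm' j Λ'))
      hΦm hslice).mono fun _ hV' _ => hV')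

end Record13

end Summit.QuantumFields.YangMills.Theorems.BalabanUVNodesN11TStepOldBranchInnerChartFluctuationSlicesOfWeightLaws

end
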